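import Summits.AtomisticToContinuum.BoseEinsteinCondensation.Theses.BECRiccatiGhostPlasma

/-!
# Crux `PinnedShadowClustering` (stmt-AtomisticToContinuum-13506) — birth skeleton (BC3), line `birth`

Route of record: `route-AtomisticToContinuum-BECRiccatiGhostPlasma` (rank 3 crux, "perfect screening of
the tagged charge", first-moment form). The crux, for every BOUNDED repulsive finite-range `v`:
`∃ K > 0 ∃ ρ₀ > 0 ∀ ρ ∈ (0, ρ₀) ∀ᶠ m`, there is an EXACT positive translation-invariant periodic ground
state `Ψ` of `N = m + 2` bosons on the torus of side `L = (N/ρ)^{1/3}` and a one-body envelope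
`θ ≤ K`, `ρ ∫_cell θ ≤ K`, such that for every measurable family of test kernels `g_k ≥ 0` and all
`x, y` the Palm expectations `E_x[G] := (N/ρ) ∫ |Ψ(x,Y)|² Σ_{B ⊆ bath} g_{|B|}(Y_B) dY` satisfy
`E_x[G] ≤ E_y[G] + Σ_k K^k ρ^k Σ_{i<k} ∫ g_k(Z) (θ(x - Z_i) + θ(y - Z_i)) dZ`.

## The cut (three registered stubs, all load-bearing; the route header's own layer-2 plan (iii)
`GroundStateRegularity → RuelleBound → PinnedClusteringProper`, typed)

* `stub_groundStateExists : GroundStateExists` — EXISTENCE/REGULARITY (spectral side): for bounded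
  admissible `v`, every `ρ > 0` and every `m`, the periodic `C¹` Bose class contains an exact minimiser
  that is strictly positive (real) and invariant under simultaneous translation of all particles
  (Perron–Frobenius for `-Δ + V^per` on the connected torus, `V^per ∈ L^∞`; `W^{2,p}`-regularity for all
  `p` gives `C^{1,α}`; uniqueness + positivity give Bose symmetry and translation invariance).
  Known mathematics, absent from Mathlib: size M–L. [ReedSimonIV1978 XIII.12/XIII.47, GilbargTrudinger2001 Thm 9.11]
* `stub_pinnedRuelleBound : PinnedRuelleBound` — MAGNITUDE (stability side): the Palm law of the shadow
  `|Ψ₀|²` seen from a tagged particle has factorial-moment densities `≤ (K₁ρ)^k` at every order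
  `k ≤ m + 1`, in test-function form `E_x[Σ_{|B|=k} h(Y_B)] ≤ K₁^k ρ^k ∫_{cell^k} h` (free gas: equality
  with `C(m+1,k)(ρ/N)^k ≤ ρ^k/k!`, so `K₁ = 1`). A Ruelle/superstability-type bound for the QUANTUM
  ground state's Born law — repulsion forbids clumping; no decay information. Size L (open as stated).
  [Ruelle1970, GhoshLebowitz2017, LSSY2005]
* `stub_ratioClustering : RatioClustering` — SHAPE (screening side, the hard stub): magnitude-free,
  RATIO clustering of the pinned laws at `x` and at `y`: `E_x[G] ≤ E_y[G] + E_x[G♯] + E_y[G♯]` with the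
  sharpened family `g♯_k(Z) = K₂^k g_k(Z) Σ_i (θ(x - Z_i) + θ(y - Z_i))`, `θ ≤ K₂`, `ρ∫θ ≤ K₂` — pointwise
  this reads `ρ_x^{(k)}(Z) (1 - K₂^k Θ) ≤ ρ_y^{(k)}(Z) (1 + K₂^k Θ)`: vacuous next to the tagged charge,
  and "the free energy of moving the half-charge ghost from `y` to `x` in the presence of `k` spectators is
  screened" away from it (McMillan/Reatto ghost picture; Brydges–Federbush screening bookkeeping). This is
  where the crux's own risk lives (a pinned three-point tail `∼ R⁻³` would force `ρ∫θ ∼ log L`).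
  Size XL / open-problem. [BrydgesFederbush1980, BrydgesMartin1999, Reatto1969, Feenberg1969, PeilenSerfaty2025]

## The composition (sorry-free, kernel-checked): Hölder-type pairing of SHAPE with MAGNITUDE

`PinnedShadowClustering_of : Goal.stub_groundStateExists → Goal.stub_pinnedRuelleBound →
Goal.stub_ratioClustering → PinnedShadowClustering` with `K := 2 K₁ K₂`, `ρ₀ := min ρ₁ ρ₂`: eventually in
`m` (intersection of the two `atTop` sets) take the ground state `Ψ` of stub 1 and the envelope `θ` of
stub 3 at `Ψ`; stub 3 bounds `E_x[G] - E_y[G]` by `E_x[G♯] + E_y[G♯]`, stub 2 (applied at `x` and at `y`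
to the measurable family `G♯`) bounds each by `Σ_k K₁^k ρ^k ∫ g♯_k`, and
`∫ g♯_k = K₂^k Σ_i ∫ g_k (θ(x - Z_i) + θ(y - Z_i))` (Tonelli), so the error is
`≤ Σ_k 2 K₁^k K₂^k ρ^k Σ_i ∫ … ≤ Σ_k (2K₁K₂)^k ρ^k Σ_i ∫ …` (`k = 0` carries no term). The envelope bounds
pass to `K ≥ K₂`. No stub is bookkeeping: existence (spectral theory), a moment bound (stability) and a
ratio-decay bound (screening) are three different kinds of statement, and none implies the crux or the
summit cheaply (BC3 probes, NOTES.md of the registering seat).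

Disproof used: none exists for this crux (`ledger crux ls stmt-AtomisticToContinuum-13506`: no workfiles,
no `Theorems/PinnedShadowClustering/Negative/` lemmas; `ledger negatives`: no Ruelle/clustering/Palm entry)
— nothing to honour yet. `v ≡ 0` sanity: `Ψ ≡ L^{-3N/2}` is the positive translation-invariant minimiser
(stub 1), `K₁ = 1` (stub 2), `θ = 0` (stub 3).

`lean check`: sorries ONLY in `stub_groundStateExists`, `stub_pinnedRuelleBound`, `stub_ratioClustering`.
-/

noncomputable section

namespace Summit.AtomisticToContinuum.BoseEinsteinCondensation.Cruxes.PinnedShadowClustering.Birth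

open scoped BigOperators ENNReal NNReal
open MeasureTheory Filter
open Literature.MathematicalPhysics.QuantumManyBody.BoseGas
open Summit.AtomisticToContinuum.BoseEinsteinCondensation.Theses.BECRiccatiGhostPlasma
  (PinnedShadowClustering)

/-! ## Vocabulary of the cut (plain definitions over the `PeriodicBoseGas` declarations) -/

/-- `Ψ` is an EXACT, strictly positive (real-valued), translation-invariant periodic ground state of
`N = m + 2` bosons at density `ρ` (torus of side `sideLength ρ (m + 2)`): verbatim the three conjuncts
the crux asks of its witness. [folklore] -/
def IsPosTIGroundState (v : ℝ → ℝ≥0∞) (ρ : ℝ) (m : ℕ)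
    (Ψ : PeriodicTrialState (m + 2) (sideLength ρ (m + 2))) : Prop :=
  periodicEnergy v Ψ = periodicGroundStateEnergy v (m + 2) (sideLength ρ (m + 2)) ∧
    (∀ X, 0 < (Ψ.ψ X).re ∧ (Ψ.ψ X).im = 0) ∧
    ∀ (a : Space) (X : Config (m + 2)), Ψ.ψ (fun i => X i + a) = Ψ.ψ X

/-- The (unnormalised-slice) PALM EXPECTATION of the crux: `E_x[G] = (N/ρ) ∫_{cell^{m+1}} |Ψ(x,Y)|²
Σ_{B ⊆ Fin (m+1)} g_{|B|}(Y_B) dY`, verbatim the left-hand side of the crux's inequality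
(`N/ρ = L³` undoes the slice mass `∫ |Ψ(x,Y)|² dY = L⁻³` of a translation-invariant state). [folklore] -/
def palmE (ρ : ℝ) (m : ℕ) (Ψ : PeriodicTrialState (m + 2) (sideLength ρ (m + 2))) (x : Space)
    (g : (k : ℕ) → Config k → ℝ≥0∞) : ℝ≥0∞ :=
  ENNReal.ofReal (((m : ℝ) + 2) / ρ) *
    (∫⁻ Y in cellN (m + 1) (sideLength ρ (m + 2)),
      (‖Ψ.ψ (Matrix.vecCons x Y)‖₊ : ENNReal) ^ 2 *
        (∑ B : Finset (Fin (m + 1)), g B.card (fun i => Y (B.orderEmbOfFin rfl i))))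

/-- The SHARPENED test family `g♯_k(Z) = K^k · g_k(Z) · Σ_{i<k} (θ(x - Z_i) + θ(y - Z_i))`: the test
kernel weighted by the two-centre one-body envelope of its own arguments. [folklore] -/
def sharpFamily (K : ℝ) (θ : Space → ℝ≥0∞) (x y : Space) (g : (k : ℕ) → Config k → ℝ≥0∞) :
    (k : ℕ) → Config k → ℝ≥0∞ :=
  fun k Z => ENNReal.ofReal (K ^ k) * (g k Z * ∑ i : Fin k, (θ (x - Z i) + θ (y - Z i)))

/-! ## The three stub statements -/

/-- **Stub 1 — existence of the positive translation-invariant ground state in the `C¹` periodic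
class.** For every bounded repulsive finite-range `v`, every `ρ > 0` and every `m`, some
`Ψ : PeriodicTrialState (m+2) (sideLength ρ (m+2))` attains `periodicGroundStateEnergy`, is strictly
positive real, and is invariant under simultaneous translation of all particles. (Perron–Frobenius on the
connected torus with `V^per ∈ L^∞`; `W^{2,p}`-regularity for every `p < ∞` hence `C^{1,α}`; the `C¹`
periodic Bose class is a form core, so the infimum is attained by the ground state.)
[cite: ReedSimonIV1978, Thm XIII.47] -/
def GroundStateExists : Prop :=
  ∀ v : ℝ → ℝ≥0∞, IsRepulsiveFiniteRange v → (∃ M : NNReal, ∀ r, v r ≤ M) →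
    ∀ ρ : ℝ, 0 < ρ → ∀ m : ℕ,
      ∃ Ψ : PeriodicTrialState (m + 2) (sideLength ρ (m + 2)), IsPosTIGroundState v ρ m Ψ

/-- **Stub 2 — pinned Ruelle (factorial-moment) bound for the shadow of the ground state.** For every
bounded repulsive finite-range `v` there are `K₁ ≥ 1` and `ρ₁ > 0` such that for `0 < ρ < ρ₁`,
eventually in `m`, every exact positive translation-invariant ground state `Ψ` satisfies, for every
measurable family `h_k ≥ 0` and every `x`,
`E_x[Σ_B h_{|B|}(Y_B)] ≤ Σ_{k ≤ m+1} K₁^k ρ^k ∫_{cell^k} h_k`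
(the Palm law's `k`-point factorial-moment densities are `≤ (K₁ρ)^k`; free gas: `C(m+1,k)(ρ/N)^k ≤ ρ^k/k!`).
[cite: Ruelle1970, superstability estimates (classical analogue)] -/
def PinnedRuelleBound : Prop :=
  ∀ v : ℝ → ℝ≥0∞, IsRepulsiveFiniteRange v → (∃ M : NNReal, ∀ r, v r ≤ M) →
    ∃ K₁ : ℝ, 1 ≤ K₁ ∧ ∃ ρ₁ : ℝ, 0 < ρ₁ ∧ ∀ ρ : ℝ, 0 < ρ → ρ < ρ₁ → ∀ᶠ m : ℕ in atTop,
      ∀ Ψ : PeriodicTrialState (m + 2) (sideLength ρ (m + 2)), IsPosTIGroundState v ρ m Ψ →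
        ∀ h : (k : ℕ) → Config k → ℝ≥0∞, (∀ k, Measurable (h k)) → ∀ x : Space,
          palmE ρ m Ψ x h ≤ ∑ k ∈ Finset.range (m + 2),
            ENNReal.ofReal (K₁ ^ k * ρ ^ k) * ∫⁻ Z in cellN k (sideLength ρ (m + 2)), h k Z

/-- **Stub 3 — ratio clustering of the pinned laws (screening of the tagged charge, magnitude-free).**
For every bounded repulsive finite-range `v` there are `K₂ ≥ 1` and `ρ₂ > 0` such that for
`0 < ρ < ρ₂`, eventually in `m`, every exact positive translation-invariant ground state `Ψ` admits a
measurable one-body envelope `θ ≤ K₂` with `ρ ∫_cell θ ≤ K₂` such that for every measurable family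
`g_k ≥ 0` and all `x, y`: `E_x[G] ≤ E_y[G] + E_x[G♯] + E_y[G♯]`, `G♯` the sharpened family
`g♯_k = K₂^k g_k Σ_i (θ(x - ·_i) + θ(y - ·_i))` — pointwise `ρ_x^{(k)} (1 - K₂^kΘ) ≤ ρ_y^{(k)} (1 + K₂^kΘ)`.
[cite: BrydgesFederbush1980, Debye screening (classical analogue); Reatto1969] -/
def RatioClustering : Prop :=
  ∀ v : ℝ → ℝ≥0∞, IsRepulsiveFiniteRange v → (∃ M : NNReal, ∀ r, v r ≤ M) →
    ∃ K₂ : ℝ, 1 ≤ K₂ ∧ ∃ ρ₂ : ℝ, 0 < ρ₂ ∧ ∀ ρ : ℝ, 0 < ρ → ρ < ρ₂ → ∀ᶠ m : ℕ in atTop,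
      ∀ Ψ : PeriodicTrialState (m + 2) (sideLength ρ (m + 2)), IsPosTIGroundState v ρ m Ψ →
        ∃ θ : Space → ℝ≥0∞, Measurable θ ∧ (∀ z, θ z ≤ ENNReal.ofReal K₂) ∧
          ENNReal.ofReal ρ * (∫⁻ z in cell (sideLength ρ (m + 2)), θ z) ≤ ENNReal.ofReal K₂ ∧
          ∀ g : (k : ℕ) → Config k → ℝ≥0∞, (∀ k, Measurable (g k)) → ∀ x y : Space,
            palmE ρ m Ψ x g ≤ palmE ρ m Ψ y g +
              (palmE ρ m Ψ x (sharpFamily K₂ θ x y g) + palmE ρ m Ψ y (sharpFamily K₂ θ x y g))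

/-! ## Registered stubs -/

namespace Goal
/-- registered obligation: existence of the positive translation-invariant ground state. -/
abbrev stub_groundStateExists : Prop := GroundStateExists
/-- registered obligation: the pinned Ruelle bound. -/
abbrev stub_pinnedRuelleBound : Prop := PinnedRuelleBound
/-- registered obligation: ratio clustering of the pinned laws. -/
abbrev stub_ratioClustering : Prop := RatioClustering
end Goal

/-- STUB 1 (existence/regularity; size M–L: Perron–Frobenius + elliptic regularity, not in Mathlib). -/
theorem stub_groundStateExists : Goal.stub_groundStateExists := by
  sorry

/-- STUB 2 (pinned Ruelle bound; size L, open as stated for the quantum ground state). -/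
theorem stub_pinnedRuelleBound : Goal.stub_pinnedRuelleBound := by
  sorry

/-- STUB 3 (ratio clustering = screening of the tagged charge; the hard stub, open-problem-sized). -/
theorem stub_ratioClustering : Goal.stub_ratioClustering := by
  sorry

/-! ## Glue (proved) -/

/-- Each member of the sharpened family is measurable. [folklore] -/
theorem measurable_sharpFamily (K : ℝ) {θ : Space → ℝ≥0∞} (hθ : Measurable θ) (x y : Space)
    {g : (k : ℕ) → Config k → ℝ≥0∞} (hg : ∀ k, Measurable (g k)) (k : ℕ) :
    Measurable (sharpFamily K θ x y g k) := by
  have hsub : ∀ (c : Space) (i : Fin k), Measurable fun Z : Config k => c - Z i :=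
    fun c i => measurable_const.sub (measurable_pi_apply i)
  have hs : Measurable fun Z : Config k => ∑ i : Fin k, (θ (x - Z i) + θ (y - Z i)) := by
    refine Finset.measurable_sum _ fun i _ => ?_
    exact (hθ.comp (hsub x i)).add (hθ.comp (hsub y i))
  exact ((hg k).mul hs).const_mul _

/-- Tonelli for the sharpened family:
`∫ g♯_k = K^k Σ_i ∫ g_k(Z) (θ(x - Z_i) + θ(y - Z_i)) dZ`. [folklore] -/
theorem setLIntegral_sharpFamily (K : ℝ) {θ : Space → ℝ≥0∞} (hθ : Measurable θ) (x y : Space)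
    {g : (k : ℕ) → Config k → ℝ≥0∞} (hg : ∀ k, Measurable (g k)) (k : ℕ) (s : Set (Config k)) :
    ∫⁻ Z in s, sharpFamily K θ x y g k Z =
      ENNReal.ofReal (K ^ k) * ∑ i : Fin k, ∫⁻ Z in s, g k Z * (θ (x - Z i) + θ (y - Z i)) := by
  have hsub : ∀ (c : Space) (i : Fin k), Measurable fun Z : Config k => c - Z i :=
    fun c i => measurable_const.sub (measurable_pi_apply i)
  have hi : ∀ i : Fin k, Measurable fun Z : Config k => g k Z * (θ (x - Z i) + θ (y - Z i)) :=
    fun i => (hg k).mul ((hθ.comp (hsub x i)).add (hθ.comp (hsub y i)))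
  have hsum : Measurable fun Z : Config k => ∑ i : Fin k, (θ (x - Z i) + θ (y - Z i)) :=
    Finset.measurable_sum _ fun i _ => (hθ.comp (hsub x i)).add (hθ.comp (hsub y i))
  have hs : Measurable fun Z : Config k => g k Z * ∑ i : Fin k, (θ (x - Z i) + θ (y - Z i)) :=
    (hg k).mul hsum
  unfold sharpFamily
  rw [lintegral_const_mul _ hs]
  congr 1
  simp_rw [Finset.mul_sum]
  exact lintegral_finsetSum _ fun i _ => hi i

/-- The real-number coefficient inequality `2 K₁^k ρ^k K₂^k ≤ (2K₁K₂)^k ρ^k` for `k ≥ 1`. [folklore] -/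
theorem coeff_le {K₁ K₂ ρ : ℝ} (hK₁ : 1 ≤ K₁) (hK₂ : 1 ≤ K₂) (hρ : 0 < ρ) {k : ℕ} (hk : 0 < k) :
    2 * (K₁ ^ k * ρ ^ k) * K₂ ^ k ≤ (2 * K₁ * K₂) ^ k * ρ ^ k := by
  have h2k : (2 : ℝ) ≤ 2 ^ k := le_self_pow₀ (by norm_num) hk.ne'
  have hA : 0 ≤ (K₁ ^ k * ρ ^ k) * K₂ ^ k := by positivity
  have : (2 * K₁ * K₂) ^ k * ρ ^ k = 2 ^ k * ((K₁ ^ k * ρ ^ k) * K₂ ^ k) := by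
    rw [mul_pow, mul_pow]; ring
  rw [this, mul_assoc]
  exact mul_le_mul_of_nonneg_right h2k hA

/-! ## The composition: the crux BY NAME from the three stubs -/

/-- **`PinnedShadowClustering` (the route decl, BY NAME) from the three stub statements** — the
skeleton theorem, kernel-checked and sorry-free: ground state from stub 1, envelope from stub 3,
and the error `E_x[G♯] + E_y[G♯]` charged through stub 2 (`K := 2K₁K₂`, `ρ₀ := min ρ₁ ρ₂`). [folklore] -/
theorem PinnedShadowClustering_of (h₁ : Goal.stub_groundStateExists)
    (h₂ : Goal.stub_pinnedRuelleBound) (h₃ : Goal.stub_ratioClustering) :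
    PinnedShadowClustering := by
  intro v hv hM
  obtain ⟨K₁, hK₁, ρ₁, hρ₁, hR⟩ := h₂ v hv hM
  obtain ⟨K₂, hK₂, ρ₂, hρ₂, hT⟩ := h₃ v hv hM
  refine ⟨2 * K₁ * K₂, by positivity, min ρ₁ ρ₂, lt_min hρ₁ hρ₂, fun ρ hρ hρlt => ?_⟩
  filter_upwards [hR ρ hρ (hρlt.trans_le (min_le_left _ _)),
    hT ρ hρ (hρlt.trans_le (min_le_right _ _))] with m hRm hTm
  obtain ⟨Ψ, hΨ⟩ := h₁ v hv hM ρ hρ m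
  obtain ⟨θ, hθm, hθK, hθint, hclust⟩ := hTm Ψ hΨ
  have hK₂K : ENNReal.ofReal K₂ ≤ ENNReal.ofReal (2 * K₁ * K₂) :=
    ENNReal.ofReal_le_ofReal (by nlinarith)
  refine ⟨Ψ, hΨ.1, hΨ.2.1, hΨ.2.2, θ, hθm, fun z => (hθK z).trans hK₂K, hθint.trans hK₂K,
    fun g hg x y => ?_⟩
  -- the sharpened family is measurable, so stub 2 applies to it at `x` and at `y`
  have hmeas : ∀ k, Measurable (sharpFamily K₂ θ x y g k) :=
    measurable_sharpFamily K₂ hθm x y hg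
  have hx := hRm Ψ hΨ (sharpFamily K₂ θ x y g) hmeas x
  have hy := hRm Ψ hΨ (sharpFamily K₂ θ x y g) hmeas y
  show palmE ρ m Ψ x g ≤ palmE ρ m Ψ y g + _
  calc palmE ρ m Ψ x g
      ≤ palmE ρ m Ψ y g +
          (palmE ρ m Ψ x (sharpFamily K₂ θ x y g) + palmE ρ m Ψ y (sharpFamily K₂ θ x y g)) :=
        hclust g hg x y
    _ ≤ palmE ρ m Ψ y g +
          ((∑ k ∈ Finset.range (m + 2), ENNReal.ofReal (K₁ ^ k * ρ ^ k) *
              ∫⁻ Z in cellN k (sideLength ρ (m + 2)), sharpFamily K₂ θ x y g k Z) +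
            ∑ k ∈ Finset.range (m + 2), ENNReal.ofReal (K₁ ^ k * ρ ^ k) *
              ∫⁻ Z in cellN k (sideLength ρ (m + 2)), sharpFamily K₂ θ x y g k Z) :=
        add_le_add le_rfl (add_le_add hx hy)
    _ = palmE ρ m Ψ y g +
          ∑ k ∈ Finset.range (m + 2), 2 * (ENNReal.ofReal (K₁ ^ k * ρ ^ k) *
              ∫⁻ Z in cellN k (sideLength ρ (m + 2)), sharpFamily K₂ θ x y g k Z) := by
        rw [← two_mul, Finset.mul_sum]
    _ ≤ palmE ρ m Ψ y g +
          ∑ k ∈ Finset.range (m + 2), ENNReal.ofReal ((2 * K₁ * K₂) ^ k * ρ ^ k) *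
            ∑ i : Fin k, (∫⁻ Z in cellN k (sideLength ρ (m + 2)),
              g k Z * (θ (x - Z i) + θ (y - Z i))) := by
        refine add_le_add le_rfl (Finset.sum_le_sum fun k _ => ?_)
        rw [setLIntegral_sharpFamily K₂ hθm x y hg k]
        rcases Nat.eq_zero_or_pos k with rfl | hk
        · simp
        · have hce : ENNReal.ofReal (2 * (K₁ ^ k * ρ ^ k) * K₂ ^ k) =
              2 * ENNReal.ofReal (K₁ ^ k * ρ ^ k) * ENNReal.ofReal (K₂ ^ k) := by
            rw [ENNReal.ofReal_mul (p := 2 * (K₁ ^ k * ρ ^ k)) (q := K₂ ^ k) (by positivity),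
              ENNReal.ofReal_mul (p := 2) (q := K₁ ^ k * ρ ^ k) (by norm_num),
              ENNReal.ofReal_ofNat]
          calc 2 * (ENNReal.ofReal (K₁ ^ k * ρ ^ k) * (ENNReal.ofReal (K₂ ^ k) *
                ∑ i : Fin k, ∫⁻ Z in cellN k (sideLength ρ (m + 2)),
                  g k Z * (θ (x - Z i) + θ (y - Z i))))
              = ENNReal.ofReal (2 * (K₁ ^ k * ρ ^ k) * K₂ ^ k) *
                  ∑ i : Fin k, ∫⁻ Z in cellN k (sideLength ρ (m + 2)),
                    g k Z * (θ (x - Z i) + θ (y - Z i)) := by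
                rw [hce]
                ring
            _ ≤ ENNReal.ofReal ((2 * K₁ * K₂) ^ k * ρ ^ k) *
                  ∑ i : Fin k, ∫⁻ Z in cellN k (sideLength ρ (m + 2)),
                    g k Z * (θ (x - Z i) + θ (y - Z i)) :=
                mul_le_mul' (ENNReal.ofReal_le_ofReal (coeff_le hK₁ hK₂ hρ hk)) le_rfl

/-- The crux from the three open stubs (displayed modulo the three sorries; its only non-whitelisted
axiom is the `sorryAx` of the stubs, and it closes the crux the day all three are theorems). [folklore] -/
theorem pinnedShadowClustering_skeleton : PinnedShadowClustering :=
  PinnedShadowClustering_of stub_groundStateExists stub_pinnedRuelleBound stub_ratioClustering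

end Summit.AtomisticToContinuum.BoseEinsteinCondensation.Cruxes.PinnedShadowClustering.Birth

end
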